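import Mathlib
import Literature.AlgebraicGeometry.Resolution.AffineBlowupIntegral
import Summits.ResolutionOfSingularities.ResolutionOfSingularities.Theorems.WildQuotientsWildQuotientResolutionJordanThreeOneBlowup
import Summits.ResolutionOfSingularities.ResolutionOfSingularities.Theorems.WildQuotientsWildQuotientResolutionHalf111ChartS
import Summits.ResolutionOfSingularities.ResolutionOfSingularities.Theorems.WildQuotientsWildQuotientResolutionHalf111ChartA
import Summits.ResolutionOfSingularities.ResolutionOfSingularities.Theorems.WildQuotientsWildQuotientResolutionHalf111ChartN

/-!
# V4U `μ₂`-exit (C4½): ONE blow-up resolves `½(1,1,1) × 𝔸^{n−3}`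

(crux stmt-ResolutionOfSingularities-15640 `WildQuotients.WildQuotientResolution`, line `Sketch`,
sector `|G| = p`; programme V4U of `L/w45c/CHAIN.md` v6 §4 row stub-4 «C4½
`coneHalf_affineBlowup_isRegular`» / `V4U-DESIGN.md` §2. [OURS · L1 W4.5c] — NOT a statement of any
manuscript; replaces the role of no printed item. Prover res-L1-w45c-stub-4.)

The blow-up of the presented ring `A = k[Y]/ker (Half111.presentation)` (`≅ R₂ ⊗ k[passengers]`,
`R₂ = k[s², sA, sN, A², AN, N²]` the invariant ring of `½(1,1,1)`) along the ideal `𝔪` of the six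
generator classes is REGULAR, integral, and proper birational: the three vertex charts
`D₊(s²t), D₊(A²t), D₊(N²t)` are affine spaces (`…Half111Chart{S,A,N}`), and the edge charts satisfy
`(sA t)² = (A² t)(s² t)`, `(sN t)² = (N² t)(s² t)`, `(AN t)² = (N² t)(A² t)` in the Rees algebra.
Same mechanism (and the same two Lean precautions: `presentation` irreducible, explicit
`Proj.basicOpen_pow`) as `…Third112Blowup`.
-/

-- single-problem summit: the doubled namespace component `ResolutionOfSingularities` is forced
set_option linter.dupNamespace false

noncomputable section

open CategoryTheory AlgebraicGeometry MvPolynomial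
open Literature.AlgebraicGeometry.Resolution

namespace Summit.ResolutionOfSingularities.ResolutionOfSingularities.Theorems.WildQuotientResolution.Half111

-- keep the presentation opaque for the unifier (the `Proj.basicOpen` rewrites below otherwise
-- unfold `aeval` terms inside the quotient ring's index and time out)
attribute [local irreducible] presentation

variable (k : Type) [Field k] (n : ℕ) (a b c : Fin n)

/-- In the Rees algebra of `𝔪`: `(sA t)² = (A² t)·(s² t)`. [folklore] -/
theorem reesT_one_sq (hab : a ≠ b) (hbc : b ≠ c) (hac : a ≠ c) :
    reesT ((fun l : Fin 6 =>
        Ideal.Quotient.mk (RingHom.ker (presentation k n a b c)) (gens k n a b c l)) 1) (Ideal.mem_span_range_self (f := (fun l : Fin 6 => Ideal.Quotient.mk (RingHom.ker (presentation k n a b c)) (gens k n a b c l))) (x := 1)) ^ 2 =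
      reesT ((fun l : Fin 6 =>
        Ideal.Quotient.mk (RingHom.ker (presentation k n a b c)) (gens k n a b c l)) 3) (Ideal.mem_span_range_self (f := (fun l : Fin 6 => Ideal.Quotient.mk (RingHom.ker (presentation k n a b c)) (gens k n a b c l))) (x := 3)) *
      reesT ((fun l : Fin 6 =>
        Ideal.Quotient.mk (RingHom.ker (presentation k n a b c)) (gens k n a b c l)) 0) (Ideal.mem_span_range_self (f := (fun l : Fin 6 => Ideal.Quotient.mk (RingHom.ker (presentation k n a b c)) (gens k n a b c l))) (x := 0)) := by
  apply Subtype.ext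
  simp only [Subalgebra.coe_pow, Subalgebra.coe_mul, coe_reesT, Polynomial.monomial_pow,
    Polynomial.monomial_mul_monomial]
  have hrel : (Ideal.Quotient.mk (RingHom.ker (presentation k n a b c)) (gens k n a b c 1)) ^ 2 =
      Ideal.Quotient.mk (RingHom.ker (presentation k n a b c)) (gens k n a b c 3) *
        Ideal.Quotient.mk (RingHom.ker (presentation k n a b c)) (gens k n a b c 0) := by
    rw [← map_pow, ← map_mul]
    apply mk_eq_of_presentation_eq
    rw [map_pow, map_mul, presentation_gens k n a b c hab hbc hac,
      presentation_gens k n a b c hab hbc hac, presentation_gens k n a b c hab hbc hac]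
    simp
    ring
  rw [hrel]

/-- In the Rees algebra of `𝔪`: `(sN t)² = (N² t)·(s² t)`. [folklore] -/
theorem reesT_two_sq (hab : a ≠ b) (hbc : b ≠ c) (hac : a ≠ c) :
    reesT ((fun l : Fin 6 =>
        Ideal.Quotient.mk (RingHom.ker (presentation k n a b c)) (gens k n a b c l)) 2) (Ideal.mem_span_range_self (f := (fun l : Fin 6 => Ideal.Quotient.mk (RingHom.ker (presentation k n a b c)) (gens k n a b c l))) (x := 2)) ^ 2 =
      reesT ((fun l : Fin 6 =>
        Ideal.Quotient.mk (RingHom.ker (presentation k n a b c)) (gens k n a b c l)) 5) (Ideal.mem_span_range_self (f := (fun l : Fin 6 => Ideal.Quotient.mk (RingHom.ker (presentation k n a b c)) (gens k n a b c l))) (x := 5)) *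
      reesT ((fun l : Fin 6 =>
        Ideal.Quotient.mk (RingHom.ker (presentation k n a b c)) (gens k n a b c l)) 0) (Ideal.mem_span_range_self (f := (fun l : Fin 6 => Ideal.Quotient.mk (RingHom.ker (presentation k n a b c)) (gens k n a b c l))) (x := 0)) := by
  apply Subtype.ext
  simp only [Subalgebra.coe_pow, Subalgebra.coe_mul, coe_reesT, Polynomial.monomial_pow,
    Polynomial.monomial_mul_monomial]
  have hrel : (Ideal.Quotient.mk (RingHom.ker (presentation k n a b c)) (gens k n a b c 2)) ^ 2 =
      Ideal.Quotient.mk (RingHom.ker (presentation k n a b c)) (gens k n a b c 5) *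
        Ideal.Quotient.mk (RingHom.ker (presentation k n a b c)) (gens k n a b c 0) := by
    rw [← map_pow, ← map_mul]
    apply mk_eq_of_presentation_eq
    rw [map_pow, map_mul, presentation_gens k n a b c hab hbc hac,
      presentation_gens k n a b c hab hbc hac, presentation_gens k n a b c hab hbc hac]
    simp
    ring
  rw [hrel]

/-- In the Rees algebra of `𝔪`: `(AN t)² = (N² t)·(A² t)`. [folklore] -/
theorem reesT_four_sq (hab : a ≠ b) (hbc : b ≠ c) (hac : a ≠ c) :
    reesT ((fun l : Fin 6 =>
        Ideal.Quotient.mk (RingHom.ker (presentation k n a b c)) (gens k n a b c l)) 4) (Ideal.mem_span_range_self (f := (fun l : Fin 6 => Ideal.Quotient.mk (RingHom.ker (presentation k n a b c)) (gens k n a b c l))) (x := 4)) ^ 2 =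
      reesT ((fun l : Fin 6 =>
        Ideal.Quotient.mk (RingHom.ker (presentation k n a b c)) (gens k n a b c l)) 5) (Ideal.mem_span_range_self (f := (fun l : Fin 6 => Ideal.Quotient.mk (RingHom.ker (presentation k n a b c)) (gens k n a b c l))) (x := 5)) *
      reesT ((fun l : Fin 6 =>
        Ideal.Quotient.mk (RingHom.ker (presentation k n a b c)) (gens k n a b c l)) 3) (Ideal.mem_span_range_self (f := (fun l : Fin 6 => Ideal.Quotient.mk (RingHom.ker (presentation k n a b c)) (gens k n a b c l))) (x := 3)) := by
  apply Subtype.ext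
  simp only [Subalgebra.coe_pow, Subalgebra.coe_mul, coe_reesT, Polynomial.monomial_pow,
    Polynomial.monomial_mul_monomial]
  have hrel : (Ideal.Quotient.mk (RingHom.ker (presentation k n a b c)) (gens k n a b c 4)) ^ 2 =
      Ideal.Quotient.mk (RingHom.ker (presentation k n a b c)) (gens k n a b c 5) *
        Ideal.Quotient.mk (RingHom.ker (presentation k n a b c)) (gens k n a b c 3) := by
    rw [← map_pow, ← map_mul]
    apply mk_eq_of_presentation_eq
    rw [map_pow, map_mul, presentation_gens k n a b c hab hbc hac,
      presentation_gens k n a b c hab hbc hac, presentation_gens k n a b c hab hbc hac]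
    simp
    ring
  rw [hrel]

/-- **The edge chart `D₊(sA t)` lies in `D₊(s² t)`.** [folklore] -/
theorem basicOpen_one_le (hab : a ≠ b) (hbc : b ≠ c) (hac : a ≠ c) :
    Proj.basicOpen (reesGrading (Ideal.span (Set.range (fun l : Fin 6 =>
        Ideal.Quotient.mk (RingHom.ker (presentation k n a b c)) (gens k n a b c l)))))
      (reesT ((fun l : Fin 6 =>
        Ideal.Quotient.mk (RingHom.ker (presentation k n a b c)) (gens k n a b c l)) 1) (Ideal.mem_span_range_self (f := (fun l : Fin 6 => Ideal.Quotient.mk (RingHom.ker (presentation k n a b c)) (gens k n a b c l))) (x := 1))) ≤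
    Proj.basicOpen (reesGrading (Ideal.span (Set.range (fun l : Fin 6 =>
        Ideal.Quotient.mk (RingHom.ker (presentation k n a b c)) (gens k n a b c l)))))
      (reesT ((fun l : Fin 6 =>
        Ideal.Quotient.mk (RingHom.ker (presentation k n a b c)) (gens k n a b c l)) 0) (Ideal.mem_span_range_self (f := (fun l : Fin 6 => Ideal.Quotient.mk (RingHom.ker (presentation k n a b c)) (gens k n a b c l))) (x := 0))) := by
  have e1 := Proj.basicOpen_pow (reesGrading (Ideal.span (Set.range (fun l : Fin 6 =>
        Ideal.Quotient.mk (RingHom.ker (presentation k n a b c)) (gens k n a b c l)))))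
    (reesT ((fun l : Fin 6 =>
        Ideal.Quotient.mk (RingHom.ker (presentation k n a b c)) (gens k n a b c l)) 1) (Ideal.mem_span_range_self (f := (fun l : Fin 6 => Ideal.Quotient.mk (RingHom.ker (presentation k n a b c)) (gens k n a b c l))) (x := 1))) 2 two_pos
  rw [← e1, reesT_one_sq k n a b c hab hbc hac, Proj.basicOpen_mul]
  exact inf_le_right

/-- **The edge chart `D₊(sN t)` lies in `D₊(s² t)`.** [folklore] -/
theorem basicOpen_two_le (hab : a ≠ b) (hbc : b ≠ c) (hac : a ≠ c) :
    Proj.basicOpen (reesGrading (Ideal.span (Set.range (fun l : Fin 6 =>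
        Ideal.Quotient.mk (RingHom.ker (presentation k n a b c)) (gens k n a b c l)))))
      (reesT ((fun l : Fin 6 =>
        Ideal.Quotient.mk (RingHom.ker (presentation k n a b c)) (gens k n a b c l)) 2) (Ideal.mem_span_range_self (f := (fun l : Fin 6 => Ideal.Quotient.mk (RingHom.ker (presentation k n a b c)) (gens k n a b c l))) (x := 2))) ≤
    Proj.basicOpen (reesGrading (Ideal.span (Set.range (fun l : Fin 6 =>
        Ideal.Quotient.mk (RingHom.ker (presentation k n a b c)) (gens k n a b c l)))))
      (reesT ((fun l : Fin 6 =>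
        Ideal.Quotient.mk (RingHom.ker (presentation k n a b c)) (gens k n a b c l)) 0) (Ideal.mem_span_range_self (f := (fun l : Fin 6 => Ideal.Quotient.mk (RingHom.ker (presentation k n a b c)) (gens k n a b c l))) (x := 0))) := by
  have e1 := Proj.basicOpen_pow (reesGrading (Ideal.span (Set.range (fun l : Fin 6 =>
        Ideal.Quotient.mk (RingHom.ker (presentation k n a b c)) (gens k n a b c l)))))
    (reesT ((fun l : Fin 6 =>
        Ideal.Quotient.mk (RingHom.ker (presentation k n a b c)) (gens k n a b c l)) 2) (Ideal.mem_span_range_self (f := (fun l : Fin 6 => Ideal.Quotient.mk (RingHom.ker (presentation k n a b c)) (gens k n a b c l))) (x := 2))) 2 two_pos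
  rw [← e1, reesT_two_sq k n a b c hab hbc hac, Proj.basicOpen_mul]
  exact inf_le_right

/-- **The edge chart `D₊(AN t)` lies in `D₊(A² t)`.** [folklore] -/
theorem basicOpen_four_le (hab : a ≠ b) (hbc : b ≠ c) (hac : a ≠ c) :
    Proj.basicOpen (reesGrading (Ideal.span (Set.range (fun l : Fin 6 =>
        Ideal.Quotient.mk (RingHom.ker (presentation k n a b c)) (gens k n a b c l)))))
      (reesT ((fun l : Fin 6 =>
        Ideal.Quotient.mk (RingHom.ker (presentation k n a b c)) (gens k n a b c l)) 4) (Ideal.mem_span_range_self (f := (fun l : Fin 6 => Ideal.Quotient.mk (RingHom.ker (presentation k n a b c)) (gens k n a b c l))) (x := 4))) ≤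
    Proj.basicOpen (reesGrading (Ideal.span (Set.range (fun l : Fin 6 =>
        Ideal.Quotient.mk (RingHom.ker (presentation k n a b c)) (gens k n a b c l)))))
      (reesT ((fun l : Fin 6 =>
        Ideal.Quotient.mk (RingHom.ker (presentation k n a b c)) (gens k n a b c l)) 3) (Ideal.mem_span_range_self (f := (fun l : Fin 6 => Ideal.Quotient.mk (RingHom.ker (presentation k n a b c)) (gens k n a b c l))) (x := 3))) := by
  have e1 := Proj.basicOpen_pow (reesGrading (Ideal.span (Set.range (fun l : Fin 6 =>
        Ideal.Quotient.mk (RingHom.ker (presentation k n a b c)) (gens k n a b c l)))))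
    (reesT ((fun l : Fin 6 =>
        Ideal.Quotient.mk (RingHom.ker (presentation k n a b c)) (gens k n a b c l)) 4) (Ideal.mem_span_range_self (f := (fun l : Fin 6 => Ideal.Quotient.mk (RingHom.ker (presentation k n a b c)) (gens k n a b c l))) (x := 4))) 2 two_pos
  rw [← e1, reesT_four_sq k n a b c hab hbc hac, Proj.basicOpen_mul]
  exact inf_le_right

/-- **C4½: `Bl_𝔪 (½(1,1,1) × 𝔸^{n−3})` is regular, integral, and proper birational** — ONE
blow-up of the reduced singular locus resolves the `μ₂`-exit cone (three affine-space vertex charts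
`D₊(s²t), D₊(A²t), D₊(N²t)`; the edge charts inside them). [OURS · L1 W4.5c] -/
theorem blowup_regular (hab : a ≠ b) (hbc : b ≠ c) (hac : a ≠ c) :
    Scheme.IsRegular (affineBlowup (Ideal.span (Set.range (fun l : Fin 6 =>
        Ideal.Quotient.mk (RingHom.ker (presentation k n a b c)) (gens k n a b c l))))) ∧
      IsIntegral (affineBlowup (Ideal.span (Set.range (fun l : Fin 6 =>
        Ideal.Quotient.mk (RingHom.ker (presentation k n a b c)) (gens k n a b c l))))) ∧
      IsProper (affineBlowup.π (Ideal.span (Set.range (fun l : Fin 6 =>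
        Ideal.Quotient.mk (RingHom.ker (presentation k n a b c)) (gens k n a b c l))))) ∧
      IsBirational (affineBlowup.π (Ideal.span (Set.range (fun l : Fin 6 =>
        Ideal.Quotient.mk (RingHom.ker (presentation k n a b c)) (gens k n a b c l))))) := by
  haveI : (RingHom.ker (presentation k n a b c)).IsPrime := RingHom.ker_isPrime _
  haveI : IsDomain (MvPolynomial (Fin n ⊕ Fin 3) k ⧸ RingHom.ker (presentation k n a b c)) :=
    (Ideal.Quotient.isDomain_iff_prime _).mpr inferInstance
  have hne : Ideal.span (Set.range (fun l : Fin 6 =>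
        Ideal.Quotient.mk (RingHom.ker (presentation k n a b c)) (gens k n a b c l))) ≠ ⊥ := by
    intro h
    rw [Ideal.span_eq_bot] at h
    have h0 := h _ ⟨0, rfl⟩
    change Ideal.Quotient.mk (RingHom.ker (presentation k n a b c)) (gens k n a b c 0) = 0 at h0
    rw [Ideal.Quotient.eq_zero_iff_mem, RingHom.mem_ker, presentation_gens k n a b c hab hbc hac]
      at h0
    simp only [Matrix.cons_val_zero] at h0
    exact pow_ne_zero 2 (X_ne_zero (R := k) a) h0
  refine ⟨JordanThree.isRegular_affineBlowup_of_charts _ fun i => ?_, affineBlowup.isIntegral hne,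
    inferInstance, affineBlowup.isBirational hne⟩
  fin_cases i
  · exact ⟨0, isRegularRing_chartRing_zero k n a b c hab hbc hac, le_rfl⟩
  · exact ⟨0, isRegularRing_chartRing_zero k n a b c hab hbc hac,
      basicOpen_one_le k n a b c hab hbc hac⟩
  · exact ⟨0, isRegularRing_chartRing_zero k n a b c hab hbc hac,
      basicOpen_two_le k n a b c hab hbc hac⟩
  · exact ⟨3, isRegularRing_chartRing_three k n a b c hab hbc hac, le_rfl⟩
  · exact ⟨3, isRegularRing_chartRing_three k n a b c hab hbc hac,
      basicOpen_four_le k n a b c hab hbc hac⟩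
  · exact ⟨5, isRegularRing_chartRing_five k n a b c hab hbc hac, le_rfl⟩

end Summit.ResolutionOfSingularities.ResolutionOfSingularities.Theorems.WildQuotientResolution.Half111

end
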